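import Literature.NumberTheory.EllipticCurves.Kato2004.MemberMultiplierInputs
import Mathlib.RingTheory.ZMod.UnitsCyclic
import Mathlib.RingTheory.RootsOfUnity.Complex
import Mathlib.NumberTheory.DirichletCharacter.Basic
import HarnessLib

/-!
# Characters of the layers `Gal(ℚ_n/ℚ)` of the cyclotomic `ℤ_p`-tower as Dirichlet characters mod `p^{n+1}` with
# kernel EXACTLY `Δ = μ_{p−1}`, and the non-vanishing of Kato's four-cusp factor `R⁻_χ̄(c,d,a,A,d′)` at such a
# character of every large level (THEOREMS ONLY; K-CUT-2 input (a), kernel part 2a)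

Topic `NumberTheory/EllipticCurves`, sub-directory `Kato2004`. THEOREMS ONLY (0 def, 0 fact, 0 instance, 0 sorry).
Seat `bsd-cm-prr-ty1` (cell `bsd-cm`), continuation of `Kato2004/ZetaBodyLayerValuesProofs.lean` (p622237): there the
vanishing of an admissible Kato zeta class forces `Lχ(1) · R⁻_χ̄ = 0` for every even Dirichlet character `χ` mod
`p^{n+1}` that kills the image `Δ` of `Gal(ℚ̄/ℚ_n)`; the road to `z₀ ≠ 0` needs, for infinitely many `n`, ONE such `χ`
with `R⁻_χ̄ ≠ 0` (this file) and `Lχ(1) ≠ 0` (Rohrlich, tree theorems). HONEST FRAMING: elementary character theory and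
one first-moment computation; nothing about `L`-values, Euler systems or BSD is asserted.

## What

For `p` an odd prime and `M = p^{n+1}`, call a Dirichlet character `χ` mod `M` a LAYER CHARACTER if its kernel on
`(ℤ/M)ˣ` is exactly `Δ = {b : b^{p−1} = 1}` (the torsion subgroup `μ_{p−1}`; Washington §13.1: `ℚ_n ⊂ ℚ(ζ_{p^{n+1}})` is
the fixed field of `Δ`, so these are the faithful characters of `Gal(ℚ_n/ℚ) ≅ ℤ/p^n`). The file keeps this as an explicit
hypothesis `∀ b, χ b = 1 ↔ b^(p−1) = 1` (no definition is introduced).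
* §1 Layer characters are even, kill every `b` with `b^{p−1} = 1`, take `p^n`-th roots of unity as values, are stable
  under `χ ↦ χ⁻¹` and `χ ↦ χ^k` (`p ∤ k`), and are PRIMITIVE of conductor `p^{n+1}` (`n ≥ 1`: `1 + p^n` lies in the
  kernel of `(ℤ/p^{n+1})ˣ → (ℤ/p^k)ˣ`, `k ≤ n`, but `(1+p^n)^{p−1} = 1 + (p−1)p^n ≠ 1`).
* §2 Existence (`exists_layerCharacter`): `(ℤ/p^{n+1})ˣ` is cyclic (odd `p`); send a generator to `e^{2πi/p^n}`.
* §3 The unit-indexed geometric sum `Σ_{k < p^n, p ∤ k} ω^k = 0` for a `p^n`-th root of unity `ω` with `ω^p ≠ 1`.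
* §4 FIRST MOMENT (`exists_layerCharacter_sum_ne_zero`): for a finite set `V` of naturals prime to `p` and complex
  weights `g` with `Σ_V g ≠ 0`, every large level carries a layer character `χ` with `Σ_{v ∈ V} g(v) χ(v) ≠ 0` — pick
  `g(v₀) ≠ 0`; for a layer character `ψ`, `Σ_{k<p^n, p∤k} ψ̄^k(v₀)·Σ_v g(v)ψ^k(v) = Σ_v g(v)·Σ_k ψ(v/v₀)^k = g(v₀)·#{k}`
  once `p^{n+1} > |v^{p(p−1)} − v₀^{p(p−1)}|` for all `v ≠ v₀` (then `ψ(v/v₀)^p ≠ 1`, §3).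
* §5 Kato's minus cusp factor `R⁻_χ̄(c,d,a,A,d′) = c²d²[a/A]⁻ − cd²χ̄(c)[ac/A]⁻ − c²dχ̄(d)[ad′/A]⁻ + cdχ̄(cd)[acd′/A]⁻`
  (`EulerSystemValues.cuspFactor f true`) is such a sum over `V = {1, |c|, |d|, |cd|}` for even `χ̄`, with total weight
  `R⁻_𝟙 = ratCuspFactor f true c d a A d′`; hence (`exists_layerCharacter_cuspFactor_ne_zero`) if `R⁻_𝟙 ≠ 0` and
  `p ∤ cd`, every large level `p^{n+1}` carries a layer character `χ` with `R⁻_{χ⁻¹} ≠ 0` — in the exact shape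
  `cuspFactor f true (fun k ↦ χ⁻¹ k) c d a A d' ≠ 0` consumed by `ZetaBodyLayerValuesProofs`.

References: L. C. Washington, *Introduction to Cyclotomic Fields* (1997) §13.1 (the layers `ℚ_n`, `Δ`), Ch. 3
(conductors) [Washington1997]; K. Kato, Astérisque 295 (2004) Thm. 6.6 (1) p. 163 and Lemma 13.10–13.11 pp. 230–231
(the four-cusp factor and its non-vanishing role) [Kato2004Asterisque].
-/

set_option autoImplicit false

noncomputable section

open scoped BigOperators
open Finset
open Literature.NumberTheory.EllipticCurves Literature.NumberTheory.EllipticCurves.ModularForms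
open Literature.NumberTheory.EllipticCurves.Kato2004.EulerSystemValues

namespace Literature.NumberTheory.EllipticCurves.Kato2004

namespace LayerCharacter

variable {p : ℕ} [hp : Fact p.Prime]

/-! ## §1 Properties of layer characters (kernel exactly `Δ = {b : b^{p-1} = 1}`) -/

section Properties

variable {M : ℕ} {χ : DirichletCharacter ℂ M}

omit hp in
/-- A layer character kills `Δ`: `b^{p−1} = 1 ⇒ χ(b) = 1`. [cite: Washington1997, §13.1] -/
theorem apply_eq_one_of_pow_eq_one (hker : ∀ b : (ZMod M)ˣ, χ b = 1 ↔ b ^ (p - 1) = 1)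
    {b : (ZMod M)ˣ} (hb : b ^ (p - 1) = 1) : χ b = 1 :=
  (hker b).mpr hb

/-- A layer character is EVEN (`p` odd: `(−1)^{p−1} = 1`). [cite: Washington1997, §13.1] -/
theorem apply_neg_one (hp2 : p ≠ 2) (hker : ∀ b : (ZMod M)ˣ, χ b = 1 ↔ b ^ (p - 1) = 1) :
    χ (-1) = 1 := by
  have heven : Even (p - 1) := hp.out.even_sub_one hp2
  have h : ((-1 : (ZMod M)ˣ) : ZMod M) = -1 := by simp
  rw [← h]
  exact apply_eq_one_of_pow_eq_one hker (by rw [heven.neg_one_pow])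

/-- `φ(p^{n+1}) = p^n (p − 1)`. [folklore] -/
private theorem totient_prime_pow_succ (n : ℕ) : Nat.totient (p ^ (n + 1)) = p ^ n * (p - 1) := by
  rw [Nat.totient_prime_pow hp.out (Nat.succ_pos n), Nat.add_one_sub_one]

/-- The values of a layer character mod `p^{n+1}` are `p^n`-th roots of unity: `χ(b)^{p^n} = χ(b^{p^n}) = 1` since
`(b^{p^n})^{p−1} = b^{φ(p^{n+1})} = 1`. [cite: Washington1997, §13.1] -/
theorem apply_pow_eq_one {n : ℕ} (hM : M = p ^ (n + 1))
    (hker : ∀ b : (ZMod M)ˣ, χ b = 1 ↔ b ^ (p - 1) = 1) (b : (ZMod M)ˣ) :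
    χ b ^ p ^ n = 1 := by
  rw [← map_pow, ← Units.val_pow_eq_pow_val]
  refine apply_eq_one_of_pow_eq_one hker ?_
  rw [← pow_mul, ← totient_prime_pow_succ, ← hM]
  exact ZMod.pow_totient b

omit hp in
/-- The inverse of a layer character is a layer character. [cite: Washington1997, §13.1] -/
theorem inv (hker : ∀ b : (ZMod M)ˣ, χ b = 1 ↔ b ^ (p - 1) = 1) :
    ∀ b : (ZMod M)ˣ, χ⁻¹ b = 1 ↔ b ^ (p - 1) = 1 := by
  intro b
  rw [MulChar.inv_apply_eq_inv', inv_eq_one, hker]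

omit hp in
/-- `χ(u⁻¹) = χ(u)⁻¹` on units. [folklore] -/
private theorem apply_units_inv (χ' : DirichletCharacter ℂ M) (u : (ZMod M)ˣ) :
    χ' ((u⁻¹ : (ZMod M)ˣ) : ZMod M) = (χ' u)⁻¹ := by
  rw [← MulChar.coe_toUnitHom, ← MulChar.coe_toUnitHom, map_inv, Units.val_inv_eq_inv_val]

omit hp in
/-- `χ(u) ≠ 0` on units. [folklore] -/
private theorem apply_units_ne_zero (χ' : DirichletCharacter ℂ M) (u : (ZMod M)ˣ) : χ' u ≠ 0 := by
  rw [← MulChar.coe_toUnitHom]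
  exact (χ'.toUnitHom u).ne_zero

/-- A root of unity of `p`-power order with a `k`-th power equal to `1`, `p ∤ k`, is `1`. [folklore] -/
private theorem eq_one_of_pow_eq_one_of_pow_prime_pow_eq_one {ω : ℂ} {n k : ℕ} (hn : ω ^ p ^ n = 1)
    (hk : ω ^ k = 1) (hpk : ¬ p ∣ k) : ω = 1 := by
  have h1 : orderOf ω ∣ p ^ n := orderOf_dvd_of_pow_eq_one hn
  have h2 : orderOf ω ∣ k := orderOf_dvd_of_pow_eq_one hk
  obtain ⟨i, -, hi⟩ := (Nat.dvd_prime_pow hp.out).mp h1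
  have hi0 : i = 0 := by
    by_contra hne
    apply hpk
    have : p ∣ orderOf ω := by rw [hi]; exact dvd_pow_self p hne
    exact this.trans h2
  rw [hi0, pow_zero] at hi
  exact orderOf_eq_one_iff.mp hi

/-- A prime-to-`p` power of a layer character mod `p^{n+1}` is a layer character. [cite: Washington1997, §13.1] -/
theorem pow {n : ℕ} (hM : M = p ^ (n + 1)) (hker : ∀ b : (ZMod M)ˣ, χ b = 1 ↔ b ^ (p - 1) = 1)
    {k : ℕ} (hk : ¬ p ∣ k) : ∀ b : (ZMod M)ˣ, (χ ^ k) b = 1 ↔ b ^ (p - 1) = 1 := by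
  intro b
  rw [MulChar.pow_apply_coe, ← hker b]
  constructor
  · intro h
    exact eq_one_of_pow_eq_one_of_pow_prime_pow_eq_one (apply_pow_eq_one hM hker b) h hk
  · intro h
    rw [h, one_pow]

omit hp in
/-- In `ℤ/p^{n+1}`, `(1 + p^n)^m = 1 + m p^n` (`p^{2n} = 0` for `n ≥ 1`). [folklore] -/
private theorem one_add_pow_eq {n : ℕ} (hn : 1 ≤ n) (m : ℕ) :
    ((1 : ZMod (p ^ (n + 1))) + (p : ZMod (p ^ (n + 1))) ^ n) ^ m =
      1 + (m : ZMod (p ^ (n + 1))) * (p : ZMod (p ^ (n + 1))) ^ n := by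
  have hsq : ((p : ZMod (p ^ (n + 1))) ^ n) ^ 2 = 0 := by
    rw [← pow_mul, ← Nat.cast_pow, ZMod.natCast_eq_zero_iff]
    exact pow_dvd_pow p (by omega)
  induction m with
  | zero => simp
  | succ m ih =>
    rw [pow_succ ((1 : ZMod (p ^ (n + 1))) + (p : ZMod (p ^ (n + 1))) ^ n) m, ih]
    push_cast
    linear_combination (m : ZMod (p ^ (n + 1))) * hsq

/-- `(1 + p^n)^{p−1} ≠ 1` in `ℤ/p^{n+1}` (it is `1 + (p−1)p^n` and `p ∤ p − 1`). [folklore] -/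
private theorem one_add_pow_sub_one_ne_one {n : ℕ} (hn : 1 ≤ n) :
    ((1 : ZMod (p ^ (n + 1))) + (p : ZMod (p ^ (n + 1))) ^ n) ^ (p - 1) ≠ 1 := by
  rw [one_add_pow_eq hn, ne_eq, add_eq_left, ← Nat.cast_pow, ← Nat.cast_mul, ZMod.natCast_eq_zero_iff]
  intro h
  have hp1 : 1 < p := hp.out.one_lt
  -- `p^{n+1} ∣ (p-1) p^n` forces `p ∣ p - 1`
  rw [pow_succ, mul_comm (p - 1)] at h
  have h' : p ∣ p - 1 := (Nat.mul_dvd_mul_iff_left (pow_pos hp.out.pos n)).mp h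
  have : p ≤ p - 1 := Nat.le_of_dvd (by omega) h'
  omega

omit hp in
/-- `1 + p^n` is a unit of `ℤ/p^{n+1}` (`n ≥ 1`). [folklore] -/
private theorem exists_unit_one_add {n : ℕ} (hn : 1 ≤ n) :
    ∃ u : (ZMod (p ^ (n + 1)))ˣ, (u : ZMod (p ^ (n + 1))) = 1 + (p : ZMod (p ^ (n + 1))) ^ n := by
  have hcop : Nat.Coprime (1 + p ^ n) (p ^ (n + 1)) := by
    refine Nat.Coprime.pow_right _ ?_
    have h1 : p ^ n = p * p ^ (n - 1) := by rw [← pow_succ', Nat.sub_add_cancel hn]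
    rw [h1, Nat.coprime_add_mul_left_left]
    exact Nat.coprime_one_left p
  exact ⟨ZMod.unitOfCoprime _ hcop, by rw [ZMod.coe_unitOfCoprime]; push_cast; ring⟩

/-- **A layer character mod `p^{n+1}` (`n ≥ 1`) is PRIMITIVE**, i.e. of conductor `p^{n+1}`: if it factored through
`p^k`, `k ≤ n`, it would kill `1 + p^n` (in the kernel of `(ℤ/p^{n+1})ˣ → (ℤ/p^k)ˣ`), but `(1 + p^n)^{p−1} ≠ 1`.
[cite: Washington1997, §13.1 and Ch. 3 (conductor)] -/
theorem isPrimitive [NeZero M] {n : ℕ} (hn : 1 ≤ n) (hM : M = p ^ (n + 1))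
    (hker : ∀ b : (ZMod M)ˣ, χ b = 1 ↔ b ^ (p - 1) = 1) : χ.IsPrimitive := by
  subst hM
  rw [DirichletCharacter.isPrimitive_def]
  -- the conductor is a divisor `p^i` of `p^{n+1}`
  have hdvd := DirichletCharacter.conductor_dvd_level χ
  obtain ⟨i, hi, hci⟩ := (Nat.dvd_prime_pow hp.out).mp hdvd
  rw [hci]
  by_contra hne
  have hin : i ≤ n := by
    have : i ≠ n + 1 := fun h => hne (by rw [h])
    omega
  -- `χ` factors through `p^i`, `i ≤ n`, hence through `p^n`
  have hfac : χ.FactorsThrough (p ^ n) := by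
    have h0 : χ.FactorsThrough (p ^ i) := by
      rw [← hci]; exact DirichletCharacter.factorsThrough_conductor χ
    exact DirichletCharacter.FactorsThrough.mono (χ := χ) (hχ := h0) (hd := pow_dvd_pow p hin)
      (hm := pow_dvd_pow p (Nat.le_succ n))
  rw [DirichletCharacter.factorsThrough_iff_ker_unitsMap (pow_dvd_pow p (Nat.le_succ n))] at hfac
  obtain ⟨u, hu⟩ := exists_unit_one_add (p := p) hn
  have hker_u : u ∈ (ZMod.unitsMap (pow_dvd_pow p (Nat.le_succ n))).ker := by
    rw [MonoidHom.mem_ker]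
    ext
    rw [ZMod.unitsMap_def, Units.coe_map, Units.val_one, hu]
    change ZMod.castHom (pow_dvd_pow p (Nat.le_succ n)) (ZMod (p ^ n)) (1 + (p : ZMod (p ^ (n + 1))) ^ n) = 1
    rw [map_add, map_one, map_pow, map_natCast, ← Nat.cast_pow, ZMod.natCast_self, add_zero]
  have h1 : χ u = 1 := by
    have := hfac hker_u
    rw [MonoidHom.mem_ker] at this
    rw [← MulChar.coe_toUnitHom, this, Units.val_one]
  have h2 : u ^ (p - 1) ≠ 1 := by
    intro h
    apply one_add_pow_sub_one_ne_one (p := p) hn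
    rw [← hu, ← Units.val_pow_eq_pow_val, h, Units.val_one]
  exact h2 ((hker u).mp h1)

end Properties

/-! ## §2 Existence of layer characters -/

section Existence

/-- **Layer characters exist at every level**: `(ℤ/p^{n+1})ˣ` is cyclic for odd `p` (Gauss); map a generator `g`
(of order `p^n(p−1)`) to `ζ = e^{2πi/p^n}`; then `χ(g^i) = ζ^i = 1 ⟺ p^n ∣ i ⟺ (g^i)^{p−1} = 1`.
[cite: Washington1997, §13.1] -/
theorem exists_layerCharacter (hp2 : p ≠ 2) (n : ℕ) {M : ℕ} [NeZero M] (hM : M = p ^ (n + 1)) :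
    ∃ χ : DirichletCharacter ℂ M, ∀ b : (ZMod M)ˣ, χ b = 1 ↔ b ^ (p - 1) = 1 := by
  subst hM
  haveI : IsCyclic (ZMod (p ^ (n + 1)))ˣ := ZMod.isCyclic_units_of_prime_pow p hp.out hp2 (n + 1)
  obtain ⟨g, hg⟩ := IsCyclic.exists_generator (α := (ZMod (p ^ (n + 1)))ˣ)
  have hord : orderOf g = p ^ n * (p - 1) := by
    rw [orderOf_eq_card_of_forall_mem_zpowers hg, Nat.card_eq_fintype_card, ZMod.card_units_eq_totient,
      totient_prime_pow_succ]
  have hpn : p ^ n ≠ 0 := pow_ne_zero _ hp.out.ne_zero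
  have hζ : IsPrimitiveRoot (Complex.exp (2 * Real.pi * Complex.I / (p ^ n : ℕ))) (p ^ n) :=
    Complex.isPrimitiveRoot_exp (p ^ n) hpn
  set ζu : ℂˣ := Units.mk0 _ (hζ.ne_zero hpn) with hζu
  have hordζ : orderOf ζu = p ^ n := by
    rw [← orderOf_units, hζu, Units.val_mk0]
    exact hζ.eq_orderOf.symm
  have hdvd : orderOf ζu ∣ orderOf g := by
    rw [hordζ, hord]
    exact dvd_mul_right _ _
  refine ⟨MulChar.ofUnitHom (monoidHomOfForallMemZpowers hg hdvd), fun b => ?_⟩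
  rw [MulChar.ofUnitHom_coe, Units.val_eq_one]
  obtain ⟨i, rfl⟩ := Subgroup.mem_zpowers_iff.mp (hg b)
  rw [map_zpow, monoidHomOfForallMemZpowers_apply_gen, ← orderOf_dvd_iff_zpow_eq_one, hordζ, ← zpow_natCast,
    ← zpow_mul, ← orderOf_dvd_iff_zpow_eq_one, hord]
  have hp1 : ((p - 1 : ℕ) : ℤ) ≠ 0 := by
    have := hp.out.two_le
    exact_mod_cast (show p - 1 ≠ 0 by omega)
  push_cast
  rw [mul_dvd_mul_iff_right hp1]

end Existence

/-! ## §3 The unit-indexed geometric sum -/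

section Sums

/-- The multiples of `p` below `p^n` (`n ≥ 1`) are the `p·j`, `j < p^{n−1}`. [folklore] -/
private theorem filter_dvd_range_eq_image {n : ℕ} (hn : 1 ≤ n) :
    (range (p ^ n)).filter (fun k => p ∣ k) = (range (p ^ (n - 1))).image (fun j => p * j) := by
  ext k
  simp only [mem_filter, mem_range, mem_image]
  have hpn : p ^ n = p * p ^ (n - 1) := by
    rw [← pow_succ', Nat.sub_add_cancel hn]
  constructor
  · rintro ⟨hk, j, rfl⟩
    refine ⟨j, ?_, rfl⟩
    rw [hpn] at hk
    exact Nat.lt_of_mul_lt_mul_left hk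
  · rintro ⟨j, hj, rfl⟩
    refine ⟨?_, dvd_mul_right p j⟩
    rw [hpn]
    exact Nat.mul_lt_mul_of_pos_left hj hp.out.pos

/-- **`Σ_{k < p^n, p ∤ k} ω^k = 0` for a `p^n`-th root of unity `ω` with `ω^p ≠ 1`** (`n ≥ 1`): the full sum
`Σ_{k<p^n} ω^k` and the sum over multiples of `p`, `Σ_{j<p^{n−1}} (ω^p)^j`, both vanish. [folklore] -/
private theorem sum_filter_not_dvd_pow_eq_zero {n : ℕ} (hn : 1 ≤ n) {ω : ℂ} (hω : ω ^ p ^ n = 1)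
    (hωp : ω ^ p ≠ 1) : ∑ k ∈ (range (p ^ n)).filter (fun k => ¬ p ∣ k), ω ^ k = 0 := by
  have hω1 : ω ≠ 1 := by
    rintro rfl
    exact hωp (one_pow p)
  have hall : ∑ k ∈ range (p ^ n), ω ^ k = 0 := by
    rw [geom_sum_eq hω1, hω, sub_self, zero_div]
  have hmul : ∑ k ∈ (range (p ^ n)).filter (fun k => p ∣ k), ω ^ k = 0 := by
    rw [filter_dvd_range_eq_image hn, sum_image (fun a _ b _ h => Nat.eq_of_mul_eq_mul_left hp.out.pos h)]
    simp_rw [pow_mul]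
    rw [geom_sum_eq hωp, ← pow_mul, ← pow_succ', Nat.sub_add_cancel hn, hω, sub_self, zero_div]
  have hsplit := sum_filter_add_sum_filter_not (range (p ^ n)) (fun k => p ∣ k) (fun k => ω ^ k)
  rw [hall, hmul, zero_add] at hsplit
  exact hsplit

/-- `Σ_{k < p^n, p ∤ k} 1 ≠ 0` (the term `k = 1` is present). [folklore] -/
private theorem card_filter_not_dvd_ne_zero (n : ℕ) (hn : 1 ≤ n) :
    (((range (p ^ n)).filter (fun k => ¬ p ∣ k)).card : ℂ) ≠ 0 := by
  rw [Nat.cast_ne_zero, ← pos_iff_ne_zero, card_pos]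
  refine ⟨1, mem_filter.mpr ⟨mem_range.mpr ?_, ?_⟩⟩
  · exact Nat.one_lt_pow (by omega) hp.out.one_lt
  · exact hp.out.not_dvd_one

end Sums

/-! ## §4 The first moment: a layer character with `Σ_v g(v) χ(v) ≠ 0` at every large level -/

section FirstMoment

/-- Distinct naturals have distinct `e`-th powers (`e ≥ 1`), and a congruence between them bounds the modulus.
[folklore] -/
private theorem not_modEq_pow_of_lt {v w e M : ℕ} (hvw : v ≠ w) (he : e ≠ 0) (hM : v ^ e + w ^ e < M) :
    ¬ v ^ e ≡ w ^ e [MOD M] := by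
  intro h
  have hne : v ^ e ≠ w ^ e := fun h' => hvw (Nat.pow_left_injective he h')
  rcases Nat.lt_or_gt_of_ne hne with hlt | hlt
  · have hd := (Nat.modEq_iff_dvd' hlt.le).mp h
    have := Nat.le_of_dvd (Nat.sub_pos_of_lt hlt) hd
    omega
  · have hd := (Nat.modEq_iff_dvd' hlt.le).mp h.symm
    have := Nat.le_of_dvd (Nat.sub_pos_of_lt hlt) hd
    omega

/-- **First moment.** Let `p` be odd, `V` a finite set of naturals prime to `p`, and `g : ℕ → ℂ` with
`Σ_{v ∈ V} g(v) ≠ 0`. Then for all large `n`, at level `M = p^{n+1}` there is a layer character `χ` (kernel exactly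
`Δ`) with `Σ_{v ∈ V} g(v) χ(v) ≠ 0`. Proof: pick `g(v₀) ≠ 0` and a layer character `ψ`; the characters `ψ^k`, `k < p^n`,
`p ∤ k`, are layer characters, and `Σ_k ψ(v₀)^{-k} Σ_v g(v)ψ^k(v) = Σ_v g(v) Σ_k ψ(v/v₀)^k = g(v₀)·#{k}` once
`p^{n+1} > v^{p(p−1)} + v₀^{p(p−1)}` for `v ∈ V` (then `ψ(v/v₀)^p ≠ 1` for `v ≠ v₀`: otherwise
`(v/v₀)^{p(p−1)} ≡ 1`, i.e. `v^{p(p−1)} ≡ v₀^{p(p−1)} (mod p^{n+1})`). [cite: Washington1997, §13.1] -/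
theorem exists_layerCharacter_sum_ne_zero (hp2 : p ≠ 2) (V : Finset ℕ) (hV : ∀ v ∈ V, v.Coprime p)
    (g : ℕ → ℂ) (hg : ∑ v ∈ V, g v ≠ 0) :
    ∃ n₀ : ℕ, ∀ n : ℕ, n₀ ≤ n → ∀ {M : ℕ} [NeZero M], M = p ^ (n + 1) →
      ∃ χ : DirichletCharacter ℂ M, (∀ b : (ZMod M)ˣ, χ b = 1 ↔ b ^ (p - 1) = 1) ∧
        ∑ v ∈ V, g v * χ (v : ZMod M) ≠ 0 := by
  classical
  obtain ⟨v₀, hv₀, hg₀⟩ := Finset.exists_ne_zero_of_sum_ne_zero hg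
  -- the bound `D ≥ v^{p(p-1)} + v₀^{p(p-1)}` for every `v ∈ V`
  set e : ℕ := p * (p - 1) with he
  set D : ℕ := ∑ v ∈ V, (v ^ e + v₀ ^ e) with hD
  refine ⟨D + 1, fun n hn M _ hM => ?_⟩
  subst hM
  have hn1 : 1 ≤ n := by omega
  have hp1 : 1 < p := hp.out.one_lt
  have he0 : e ≠ 0 := Nat.mul_ne_zero hp.out.ne_zero (by omega)
  have hMD : D < p ^ (n + 1) := lt_of_lt_of_le (by omega) (Nat.lt_pow_self hp1).le
  -- a layer character `ψ` and the units `u_v`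
  obtain ⟨ψ, hψ⟩ := exists_layerCharacter (p := p) hp2 n (M := p ^ (n + 1)) rfl
  have hunit : ∀ v ∈ V, ∃ u : (ZMod (p ^ (n + 1)))ˣ, (u : ZMod (p ^ (n + 1))) = v := fun v hv =>
    ⟨ZMod.unitOfCoprime v ((hV v hv).pow_right (n + 1)), ZMod.coe_unitOfCoprime v _⟩
  obtain ⟨u₀, hu₀⟩ := hunit v₀ hv₀
  have hψ₀ : ψ (v₀ : ZMod (p ^ (n + 1))) ≠ 0 := by rw [← hu₀]; exact apply_units_ne_zero ψ u₀
  -- the index set `K = {k < p^n : p ∤ k}`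
  set K : Finset ℕ := (range (p ^ n)).filter (fun k => ¬ p ∣ k) with hK
  have hKne : ((K.card : ℕ) : ℂ) ≠ 0 := card_filter_not_dvd_ne_zero (p := p) n hn1
  have hk0 : ∀ k ∈ K, k ≠ 0 := fun k hk h0 => (mem_filter.mp hk).2 (h0 ▸ dvd_zero p)
  -- suppose every `ψ^k`, `k ∈ K`, had vanishing weighted sum
  by_contra hcon
  push Not at hcon
  have hzero : ∀ k ∈ K, ∑ v ∈ V, g v * (ψ ^ k) (v : ZMod (p ^ (n + 1))) = 0 := fun k hk =>
    hcon (ψ ^ k) (pow (p := p) rfl hψ (mem_filter.mp hk).2)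
  -- the inner sums `Σ_k (ψ(v) ψ(v₀)⁻¹)^k`
  have hinner : ∀ v ∈ V, v ≠ v₀ →
      ∑ k ∈ K, (ψ (v : ZMod (p ^ (n + 1))) * (ψ (v₀ : ZMod (p ^ (n + 1))))⁻¹) ^ k = 0 := by
    intro v hv hne
    obtain ⟨u, hu⟩ := hunit v hv
    rw [← hu, ← hu₀]
    apply sum_filter_not_dvd_pow_eq_zero (p := p) hn1
    · rw [mul_pow, inv_pow, apply_pow_eq_one rfl hψ u, apply_pow_eq_one rfl hψ u₀, inv_one, mul_one]
    · -- `(ψ(u)ψ(u₀)⁻¹)^p = 1` would give `u^{p(p-1)} = u₀^{p(p-1)}`, i.e. `v^e ≡ v₀^e (mod p^{n+1})`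
      intro h1
      have h2 : ψ ((u ^ p * (u₀ ^ p)⁻¹ : (ZMod (p ^ (n + 1)))ˣ) : ZMod (p ^ (n + 1))) = 1 := by
        rw [Units.val_mul, map_mul, apply_units_inv, Units.val_pow_eq_pow_val, Units.val_pow_eq_pow_val,
          map_pow, map_pow, ← inv_pow, ← mul_pow, h1]
      have h3 := (hψ _).mp h2
      rw [mul_pow, inv_pow, mul_inv_eq_one, ← pow_mul, ← pow_mul] at h3
      have h4 : (v : ZMod (p ^ (n + 1))) ^ e = (v₀ : ZMod (p ^ (n + 1))) ^ e := by
        rw [← hu, ← hu₀, ← Units.val_pow_eq_pow_val, ← Units.val_pow_eq_pow_val, he, h3]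
      rw [← Nat.cast_pow, ← Nat.cast_pow, ZMod.natCast_eq_natCast_iff] at h4
      refine not_modEq_pow_of_lt hne he0 (lt_of_le_of_lt ?_ hMD) h4
      rw [hD]
      exact Finset.single_le_sum (f := fun v => v ^ e + v₀ ^ e) (fun _ _ => Nat.zero_le _) hv
  -- the first moment, computed two ways
  have hmoment : ∑ k ∈ K, (ψ (v₀ : ZMod (p ^ (n + 1))))⁻¹ ^ k *
      ∑ v ∈ V, g v * (ψ ^ k) (v : ZMod (p ^ (n + 1))) = g v₀ * (K.card : ℂ) := by
    calc ∑ k ∈ K, (ψ (v₀ : ZMod (p ^ (n + 1))))⁻¹ ^ k * ∑ v ∈ V, g v * (ψ ^ k) (v : ZMod (p ^ (n + 1)))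
        = ∑ v ∈ V, g v *
            ∑ k ∈ K, (ψ (v : ZMod (p ^ (n + 1))) * (ψ (v₀ : ZMod (p ^ (n + 1))))⁻¹) ^ k := by
          simp_rw [Finset.mul_sum]
          rw [Finset.sum_comm]
          refine sum_congr rfl fun v _ => sum_congr rfl fun k hk => ?_
          rw [MulChar.pow_apply' ψ (hk0 k hk), mul_pow]
          ring
      _ = g v₀ * ∑ k ∈ K, (ψ (v₀ : ZMod (p ^ (n + 1))) * (ψ (v₀ : ZMod (p ^ (n + 1))))⁻¹) ^ k +
            ∑ v ∈ V.erase v₀, g v *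
              ∑ k ∈ K, (ψ (v : ZMod (p ^ (n + 1))) * (ψ (v₀ : ZMod (p ^ (n + 1))))⁻¹) ^ k :=
          (Finset.add_sum_erase V _ hv₀).symm
      _ = g v₀ * (K.card : ℂ) := by
          rw [mul_inv_cancel₀ hψ₀, Finset.sum_eq_zero (s := V.erase v₀)]
          · simp
          · intro v hv
            rw [hinner v (mem_of_mem_erase hv) (ne_of_mem_erase hv), mul_zero]
  have hmoment' : ∑ k ∈ K, (ψ (v₀ : ZMod (p ^ (n + 1))))⁻¹ ^ k *
      ∑ v ∈ V, g v * (ψ ^ k) (v : ZMod (p ^ (n + 1))) = 0 :=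
    Finset.sum_eq_zero fun k hk => by rw [hzero k hk, mul_zero]
  rw [hmoment'] at hmoment
  exact mul_ne_zero hg₀ hKne hmoment.symm

end FirstMoment

/-! ## §5 Kato's minus four-cusp factor at a layer character -/

section CuspFactor

variable {N : ℕ} (f : CuspForm (CongruenceSubgroup.Gamma0 N) 2)

/-- An even Dirichlet character sees an integer through its absolute value: `χ(c) = χ(|c|)`. [folklore] -/
private theorem apply_intCast_eq_apply_natAbs {M : ℕ} (χ' : DirichletCharacter ℂ M) (heven : χ' (-1) = 1) (c : ℤ) :
    χ' (c : ZMod M) = χ' (c.natAbs : ZMod M) := by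
  rcases Int.natAbs_eq c with h | h
  · conv_lhs => rw [h]
    rw [Int.cast_natCast]
  · conv_lhs => rw [h]
    rw [Int.cast_neg, Int.cast_natCast, neg_eq_neg_one_mul, map_mul, heven, one_mul]

/-- **Kato's minus four-cusp factor as a weighted sum of character values over `V = {1, |c|, |d|, |cd|}`**: for an
EVEN `χ̄` (values of a Dirichlet character mod `M`),
`R⁻_χ̄(c,d,a,A,d′) = Σ_{v ∈ V} g(v)·χ̄(v)` with the weights `g` collecting the coefficients `c²d²[a/A]⁻, −cd²[ac/A]⁻,
−c²d[ad′/A]⁻, cd[acd′/A]⁻` by absolute value of `1, c, d, cd`. [cite: Kato2004Asterisque, Thm. 6.6 (1) (p. 163), Lemma 13.10 (1) (p. 230)] -/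
theorem cuspFactor_true_eq_sum {M : ℕ} (χ' : DirichletCharacter ℂ M) (heven : χ' (-1) = 1) (c d a : ℤ) (A : ℕ)
    (d' : ℤ) :
    cuspFactor f true (fun k ↦ χ' (k : ZMod M)) c d a A d' =
      ∑ v ∈ ({1, c.natAbs, d.natAbs, (c * d).natAbs} : Finset ℕ),
        ((if v = 1 then ((c : ℂ) ^ 2 * (d : ℂ) ^ 2) * ((ratMinusSymbol f ((a : ℚ) / A) : ℚ) : ℂ) else 0) +
          (if v = c.natAbs then -(((c : ℂ) * (d : ℂ) ^ 2) * ((ratMinusSymbol f ((a * c : ℚ) / A) : ℚ) : ℂ)) else 0) +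
          (if v = d.natAbs then -(((c : ℂ) ^ 2 * (d : ℂ)) * ((ratMinusSymbol f ((a * d' : ℚ) / A) : ℚ) : ℂ)) else 0) +
          (if v = (c * d).natAbs then ((c : ℂ) * (d : ℂ)) * ((ratMinusSymbol f ((a * c * d' : ℚ) / A) : ℚ) : ℂ) else 0)) *
        χ' (v : ZMod M) := by
  classical
  set V : Finset ℕ := {1, c.natAbs, d.natAbs, (c * d).natAbs} with hV
  have h1 : (1 : ℕ) ∈ V := by simp [hV]
  have hc : c.natAbs ∈ V := by simp [hV]
  have hd : d.natAbs ∈ V := by simp [hV]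
  have hcd : (c * d).natAbs ∈ V := by simp [hV]
  simp only [add_mul, Finset.sum_add_distrib, ite_mul, zero_mul, Finset.sum_ite_eq', h1, hc, hd, hcd, if_true]
  rw [cuspFactor]
  simp only [↓reduceIte]
  rw [apply_intCast_eq_apply_natAbs χ' heven c, apply_intCast_eq_apply_natAbs χ' heven d,
    apply_intCast_eq_apply_natAbs χ' heven (c * d), Nat.cast_one, map_one]
  ring

/-- The total weight of that sum is the trivial-character factor `R⁻_𝟙 = ratCuspFactor f true c d a A d′`.
[cite: Kato2004Asterisque, Thm. 6.6 (1) (p. 163)] -/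
theorem sum_weights_eq_ratCuspFactor (c d a : ℤ) (A : ℕ) (d' : ℤ) :
    ∑ v ∈ ({1, c.natAbs, d.natAbs, (c * d).natAbs} : Finset ℕ),
        ((if v = 1 then ((c : ℂ) ^ 2 * (d : ℂ) ^ 2) * ((ratMinusSymbol f ((a : ℚ) / A) : ℚ) : ℂ) else 0) +
          (if v = c.natAbs then -(((c : ℂ) * (d : ℂ) ^ 2) * ((ratMinusSymbol f ((a * c : ℚ) / A) : ℚ) : ℂ)) else 0) +
          (if v = d.natAbs then -(((c : ℂ) ^ 2 * (d : ℂ)) * ((ratMinusSymbol f ((a * d' : ℚ) / A) : ℚ) : ℂ)) else 0) +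
          (if v = (c * d).natAbs then ((c : ℂ) * (d : ℂ)) * ((ratMinusSymbol f ((a * c * d' : ℚ) / A) : ℚ) : ℂ) else 0)) =
      (ratCuspFactor f true c d a A d' : ℂ) := by
  classical
  set V : Finset ℕ := {1, c.natAbs, d.natAbs, (c * d).natAbs} with hV
  have h1 : (1 : ℕ) ∈ V := by simp [hV]
  have hc : c.natAbs ∈ V := by simp [hV]
  have hd : d.natAbs ∈ V := by simp [hV]
  have hcd : (c * d).natAbs ∈ V := by simp [hV]
  simp only [Finset.sum_add_distrib, Finset.sum_ite_eq', h1, hc, hd, hcd, if_true]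
  simp only [ratCuspFactor, ↓reduceIte]
  push_cast
  ring

/-- **Kato's minus cusp factor does not vanish at some layer character of every large level.** Let `p` be odd, `f` a
cusp form, `(c, d, a, A, d′)` parameters with `p ∤ c`, `p ∤ d` and `R⁻_𝟙 = ratCuspFactor f true c d a A d′ ≠ 0`. Then
for all large `n` there is a Dirichlet character `χ` mod `M = p^{n+1}` with kernel exactly `Δ` (a faithful character of
`Gal(ℚ_n/ℚ)`) such that `R⁻_{χ̄} ≠ 0` in the shape `cuspFactor f true (fun k ↦ χ⁻¹ k) c d a A d′ ≠ 0` of the value law.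
[cite: Kato2004Asterisque, Thm. 6.6 (1) (p. 163), Lemma 13.10 (1) and Lemma 13.11 (2) (pp. 230–231)] [cite: Washington1997, §13.1] -/
theorem exists_layerCharacter_cuspFactor_ne_zero (hp2 : p ≠ 2) {c d : ℤ} (hc : c.natAbs.Coprime p)
    (hd : d.natAbs.Coprime p) (a : ℤ) (A : ℕ) (d' : ℤ) (hR : ratCuspFactor f true c d a A d' ≠ 0) :
    ∃ n₀ : ℕ, ∀ n : ℕ, n₀ ≤ n → ∀ {M : ℕ} [NeZero M], M = p ^ (n + 1) →
      ∃ χ : DirichletCharacter ℂ M, (∀ b : (ZMod M)ˣ, χ b = 1 ↔ b ^ (p - 1) = 1) ∧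
        cuspFactor f true (fun k ↦ χ⁻¹ (k : ZMod M)) c d a A d' ≠ 0 := by
  classical
  set V : Finset ℕ := {1, c.natAbs, d.natAbs, (c * d).natAbs} with hV
  set g : ℕ → ℂ := fun v =>
    (if v = 1 then ((c : ℂ) ^ 2 * (d : ℂ) ^ 2) * ((ratMinusSymbol f ((a : ℚ) / A) : ℚ) : ℂ) else 0) +
      (if v = c.natAbs then -(((c : ℂ) * (d : ℂ) ^ 2) * ((ratMinusSymbol f ((a * c : ℚ) / A) : ℚ) : ℂ)) else 0) +
      (if v = d.natAbs then -(((c : ℂ) ^ 2 * (d : ℂ)) * ((ratMinusSymbol f ((a * d' : ℚ) / A) : ℚ) : ℂ)) else 0) +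
      (if v = (c * d).natAbs then ((c : ℂ) * (d : ℂ)) * ((ratMinusSymbol f ((a * c * d' : ℚ) / A) : ℚ) : ℂ) else 0)
    with hg
  have hVp : ∀ v ∈ V, v.Coprime p := by
    intro v hv
    simp only [hV, Finset.mem_insert, Finset.mem_singleton] at hv
    rcases hv with rfl | rfl | rfl | rfl
    · exact Nat.coprime_one_left p
    · exact hc
    · exact hd
    · rw [Int.natAbs_mul]; exact Nat.Coprime.mul_left hc hd
  have hsum : ∑ v ∈ V, g v ≠ 0 := by
    rw [hg, sum_weights_eq_ratCuspFactor f c d a A d']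
    exact_mod_cast hR
  obtain ⟨n₀, hn₀⟩ := exists_layerCharacter_sum_ne_zero (p := p) hp2 V hVp g hsum
  refine ⟨n₀, fun n hn M _ hM => ?_⟩
  obtain ⟨χ, hχ, hne⟩ := hn₀ n hn hM
  refine ⟨χ⁻¹, inv hχ, ?_⟩
  rw [inv_inv, cuspFactor_true_eq_sum f χ (apply_neg_one hp2 hχ) c d a A d']
  exact hne

end CuspFactor

end LayerCharacter

end Literature.NumberTheory.EllipticCurves.Kato2004

end
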